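import Summits.CriticalPhenomena.Ising3DConformalLimit.Theorems.HarmonicMomentsIsotropyTwoPointAsymptoticIsotropyRayScaling
import HarnessLib

/-!
# Crux `IsingEuclidUpgradeR2RotInvPowerLaw` (stmt-CriticalPhenomena-0634), line `tower_profile_rigidity`,
# variant V: the AXIS KERNEL of a sequential pair limit under the integer dilation law S2

Write `G := criticalTwoPoint 3` for the critical two-point function `⟨σ₀σ_x⟩_{β_c}` of the nearest-neighbour
Ising model on `ℤ³` and `g(n) := G(n e₀)`. The registered stub S2 `stub_integerDilationLaw` of the line is the
INTEGER DILATION LAW on the axis at exponent `Δ`: `g(kn)·k^{2Δ}/g(n) → 1` for every `k ≥ 1` (OPEN; here it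
enters only as a HYPOTHESIS). This file proves its two consequences used by variant V of the line:

* `uniformRegularity_of_dilationLaw` (C1): S2 at `k = 2` along `n = 2^j` is the convergence of the dyadic
  pair ratio of the pinned pair zoom, `g(2·2^j)/g(2^j) → 2^{-2Δ}` (`rescaled_pin_cfg0s`), whence item 6150
  `TwoPointDoubling` (`stub_twoPointDoubling_of_dyadicPairRatio`, Messager–Miracle-Solé interpolation) and
  item 4658 `UniformRegularity` of the pinned zoom (`uniformRegularity_of_doubling`, the reflection-positivity
  pedigree machinery);
* `kernel_axis_rpow_of_dilationLawAt` (C2): for every SEQUENTIAL pair limit `S₂` of the renormalised pair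
  correlator along meshes `u k → 0⁺` (any renormalisation `ρ > 0` on `(0,1]`, `S₂ > 0` off the diagonal)
  the axis kernel is an exact power: `S₂(0, t e₀) = t^{-2Δ} S₂(0, e₀)` for all `t > 0`. First the NATURAL
  dilations `S₂(0, (k s) e₀) = k^{-2Δ} S₂(0, s e₀)` (`k ≥ 1`, `s > 0`): both values are limits of
  `ρ(u_j)² G(k m_j e₀)`, `ρ(u_j)² G(m_j e₀)` at the moving rescaled sites (`m_j = ⌊s/u_j⌋`,
  `tendsto_rescaled_movingSite`), whose ratio tends to `k^{-2Δ}` by S2 along `m_j → ∞`; then the REAL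
  dilations from the rational ones `⌊(N+1)t⌋/(N+1) → t` and the continuity of the kernel off the origin
  (`continuousOn_seqLimit`).

This is the axis-only transcription of `kernel_ray_scaling_of_rayRV` / `kernel_homogeneous_of_rayRV`
(file `…TwoPointAsymptoticIsotropyRayScaling`, which assume ray regular variation in EVERY lattice
direction). References: H. Duminil-Copin, ICM 2022, §8.4 [DuminilCopinICM2022]; M. Aizenman,
H. Duminil-Copin, Ann. of Math. 194 (2021), Remark 5.10 [AizenmanDuminilCopinAnnals2021]; N. H. Bingham,
C. M. Goldie, J. L. Teugels, *Regular Variation* (CUP 1987), §1.9. No definitions are introduced; S2 itself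
is NOT proved here.
-/

noncomputable section

namespace Summit.CriticalPhenomena.Ising3DConformalLimit.Cruxes.IsingEuclidUpgradeR2RotInvPowerLaw.TowerProfileRigidity

open Literature.Probability.LatticeModels Filter Set
open scoped Topology
open Summit.CriticalPhenomena.Ising3DConformalLimit.MoebiusLimitExistsOnlyInteraction
  (rhoPin rhoPin_pos)
open Summit.CriticalPhenomena.Ising3DConformalLimit.MoebiusLimitExistsNegative
  (rescaled_pin_cfg0s)
open Summit.CriticalPhenomena.Ising3DConformalLimit.HyperoctahedralRPTwoPoint
open Summit.CriticalPhenomena.Ising3DConformalLimit.Cruxes.ExistsScaleCovariantLimit.TwoHierarchies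
  (continuousOn_seqLimit stub_twoPointDoubling_of_dyadicPairRatio)
open Summit.CriticalPhenomena.Ising3DConformalLimit.Cruxes.ExistsScaleCovariantLimit.TwoHierarchies.ItemMaps
  (uniformRegularity_of_doubling eventually_mem_Ioo_of_tendsto_nhdsGT')
open Summit.CriticalPhenomena.Ising3DConformalLimit.Theses
open Summit.CriticalPhenomena.Ising3DConformalLimit.HarmonicMomentsIsotropyTwoPoint.RayRV

namespace AxisKernel

/-! ### S2 in ratio form -/

/-- From the S2-shaped law `g(kn)·k^{2Δ}/g(n) → 1` to the ratio form `g(kn)/g(n) → k^{-2Δ}`. [folklore] -/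
theorem ratio_tendsto {Δ : ℝ}
    (hS2 : ∀ k : ℕ, 1 ≤ k → Tendsto (fun n : ℕ => criticalTwoPoint 3 (Pi.single 0 ((k * n : ℕ) : ℤ)) *
      (k : ℝ) ^ (2 * Δ) / criticalTwoPoint 3 (Pi.single 0 ((n : ℕ) : ℤ))) atTop (𝓝 1))
    {k : ℕ} (hk : 1 ≤ k) :
    Tendsto (fun n : ℕ => criticalTwoPoint 3 (Pi.single 0 ((k * n : ℕ) : ℤ)) /
      criticalTwoPoint 3 (Pi.single 0 ((n : ℕ) : ℤ))) atTop (𝓝 ((k : ℝ) ^ (-(2 * Δ)))) := by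
  have hk0 : (0 : ℝ) < k := by exact_mod_cast hk
  have hne : (k : ℝ) ^ (2 * Δ) ≠ 0 := (Real.rpow_pos_of_pos hk0 _).ne'
  have h := (hS2 k hk).mul_const ((k : ℝ) ^ (-(2 * Δ)))
  rw [one_mul] at h
  refine h.congr fun n => ?_
  rw [Real.rpow_neg hk0.le, div_mul_eq_mul_div, mul_assoc, mul_inv_cancel₀ hne, mul_one]

/-! ### (C1) The dyadic pair ratio, doubling, uniform regularity -/

/-- **S2 gives the convergence of the dyadic doubling ratio**: the pinned pair zoom at the mesh `2^{-j}`
and the pair `(0, 2e₀)` is `g(2·2^j)/g(2^j) → 2^{-2Δ}`. [cite: AizenmanDuminilCopinAnnals2021, Remark 5.10] -/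
theorem tendsto_dyadicPairRatio {Δ : ℝ}
    (hS2 : ∀ k : ℕ, 1 ≤ k → Tendsto (fun n : ℕ => criticalTwoPoint 3 (Pi.single 0 ((k * n : ℕ) : ℤ)) *
      (k : ℝ) ^ (2 * Δ) / criticalTwoPoint 3 (Pi.single 0 ((n : ℕ) : ℤ))) atTop (𝓝 1)) :
    Tendsto (fun j : ℕ => rescaledCorrelator (criticalCorr 3) rhoPin 2 (((2:ℝ) ^ j)⁻¹)
      (![0, EuclideanSpace.single 0 (2:ℝ)] : Fin 2 → EuclideanSpace ℝ (Fin 3))) atTop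
      (𝓝 ((2:ℝ) ^ (-(2 * Δ)))) := by
  have h2 := (ratio_tendsto hS2 (k := 2) (by norm_num)).comp
    (tendsto_pow_atTop_atTop_of_one_lt (one_lt_two : (1:ℕ) < 2))
  have h2r : (((2:ℕ) : ℝ)) = (2:ℝ) := by norm_num
  rw [h2r] at h2
  refine h2.congr fun j => ?_
  simp only [Function.comp_apply]
  rw [rescaled_pin_cfg0s]
  have hf1 : ⌊(2:ℝ) / ((2:ℝ) ^ j)⁻¹⌋ = ((2 * 2 ^ j : ℕ) : ℤ) := by
    rw [div_inv_eq_mul, show (2:ℝ) * 2 ^ j = ((2 * 2 ^ j : ℕ) : ℝ) by push_cast; ring,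
      Int.floor_natCast]
  have hf2 : ⌊(1:ℝ) / ((2:ℝ) ^ j)⁻¹⌋ = ((2 ^ j : ℕ) : ℤ) := by
    rw [div_inv_eq_mul, one_mul, show (2:ℝ) ^ j = ((2 ^ j : ℕ) : ℝ) by push_cast; ring,
      Int.floor_natCast]
  rw [hf1, hf2]

/-! ### (C2) Lattice bookkeeping on the axis -/

/-- The embedded axis site: `siteVec (m e₀) = m • e₀` in `ℝ³`. [folklore] -/
theorem siteVec_single (m : ℤ) :
    siteVec (Pi.single (0 : Fin 3) m : Site 3) = (m : ℝ) • EuclideanSpace.single (0 : Fin 3) (1:ℝ) := by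
  ext j
  rw [siteVec_apply, PiLp.smul_apply, PiLp.single_apply, Pi.single_apply, smul_eq_mul, mul_ite,
    mul_one, mul_zero]
  split_ifs <;> simp

/-- `a • (b e₀) = (a b) e₀`. [folklore] -/
theorem smul_single_zero (a b : ℝ) :
    a • EuclideanSpace.single (0 : Fin 3) b = EuclideanSpace.single 0 (a * b) := by
  ext j
  rw [PiLp.smul_apply, PiLp.single_apply, PiLp.single_apply, smul_eq_mul, mul_ite, mul_zero]

/-- `e₀ ≠ 0` in `ℝ³`. [folklore] -/
theorem single_zero_one_ne_zero : (EuclideanSpace.single (0 : Fin 3) (1:ℝ)) ≠ 0 := by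
  intro h
  have := congrArg (fun v : EuclideanSpace ℝ (Fin 3) => v 0) h
  simp at this

/-! ### (C2) Natural dilations of the axis kernel of a sequential pair limit -/

/-- **Natural dilations of the axis kernel under S2.** For every sequential pair limit `S₂`
(renormalisation `ρ > 0` on `(0,1]`, `S₂ > 0` off the diagonal), every `s > 0` and `k ≥ 1`:
`S₂(0, (k s) e₀) = k^{-2Δ} S₂(0, s e₀)` — the two values are limits of `ρ(u_j)² g(k m_j)` and
`ρ(u_j)² g(m_j)` at the moving rescaled sites (`m_j = ⌊s/u_j⌋`), whose ratio tends to `k^{-2Δ}` by S2.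
[cite: DuminilCopinICM2022, §8.4] -/
theorem kernel_natMul {Δ : ℝ}
    (hS2 : ∀ k : ℕ, 1 ≤ k → Tendsto (fun n : ℕ => criticalTwoPoint 3 (Pi.single 0 ((k * n : ℕ) : ℤ)) *
      (k : ℝ) ^ (2 * Δ) / criticalTwoPoint 3 (Pi.single 0 ((n : ℕ) : ℤ))) atTop (𝓝 1))
    {ρ : ℝ → ℝ} (hρ : ∀ δ ∈ Set.Ioc (0:ℝ) 1, 0 < ρ δ) {u : ℕ → ℝ} (hu : Tendsto u atTop (𝓝[>] (0 : ℝ)))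
    {S2 : (Fin 2 → EuclideanSpace ℝ (Fin 3)) → ℝ}
    (hconv2 : TendstoLocallyUniformlyOn (fun k => rescaledCorrelator (criticalCorr 3) ρ 2 (u k)) S2 atTop
      (NonCoincident 3 2))
    (hpos : ∀ z ∈ NonCoincident 3 2, 0 < S2 z)
    {s : ℝ} (hs : 0 < s) {k : ℕ} (hk : 1 ≤ k) :
    S2 ![0, ((k : ℝ) * s) • EuclideanSpace.single (0 : Fin 3) (1:ℝ)] =
      (k : ℝ) ^ (-(2 * Δ)) * S2 ![0, s • EuclideanSpace.single (0 : Fin 3) (1:ℝ)] := by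
  set e : EuclideanSpace ℝ (Fin 3) := EuclideanSpace.single (0 : Fin 3) (1:ℝ) with he
  set m : ℕ → ℕ := fun j => ⌊s / u j⌋₊ with hm
  have hk0 : (0 : ℝ) < k := by exact_mod_cast hk
  have hev : e ≠ 0 := single_zero_one_ne_zero
  have hsx : s • e ≠ 0 := smul_ne_zero hs.ne' hev
  have hksx : ((k : ℝ) * s) • e ≠ 0 := smul_ne_zero (mul_pos hk0 hs).ne' hev
  -- the two sequences of rescaled sites and their limits
  have hA : Tendsto (fun j => ρ (u j) ^ 2 * criticalTwoPoint 3 (Pi.single 0 ((m j : ℕ) : ℤ)))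
      atTop (𝓝 (S2 ![0, s • e])) := by
    refine tendsto_rescaled_movingSite hu hconv2 hsx ?_
    have h := (tendsto_mul_natFloor_div hu hs).smul_const e
    refine h.congr fun j => ?_
    rw [siteVec_single, ← he, smul_smul, hm]
    push_cast
    ring_nf
  have hB : Tendsto (fun j => ρ (u j) ^ 2 * criticalTwoPoint 3 (Pi.single 0 ((k * m j : ℕ) : ℤ)))
      atTop (𝓝 (S2 ![0, ((k : ℝ) * s) • e])) := by
    refine tendsto_rescaled_movingSite hu hconv2 hksx ?_
    have h := ((tendsto_mul_natFloor_div hu hs).const_mul (k : ℝ)).smul_const e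
    refine h.congr fun j => ?_
    rw [siteVec_single, ← he, smul_smul, hm]
    push_cast
    ring_nf
  -- the ratio tends to `k^{-2Δ}` by S2 along `m_j → ∞`
  have hmtop : Tendsto m atTop atTop := by
    have h1 : Tendsto (fun j => s / u j) atTop atTop := by
      have h := (tendsto_inv_nhdsGT_zero.comp hu).const_mul_atTop hs
      refine h.congr fun j => ?_
      simp [div_eq_mul_inv]
    exact tendsto_nat_floor_atTop.comp h1
  have hR := (ratio_tendsto hS2 hk).comp hmtop
  -- the ratio of the two sequences
  have hApos : 0 < S2 ![0, s • e] := hpos _ (zero_pair_mem_nonCoincident hsx)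
  have hQ := hB.div hA hApos.ne'
  have hev' : ∀ᶠ j in atTop, ρ (u j) ^ 2 * criticalTwoPoint 3 (Pi.single 0 ((k * m j : ℕ) : ℤ)) /
      (ρ (u j) ^ 2 * criticalTwoPoint 3 (Pi.single 0 ((m j : ℕ) : ℤ))) =
      criticalTwoPoint 3 (Pi.single 0 ((k * m j : ℕ) : ℤ)) /
        criticalTwoPoint 3 (Pi.single 0 ((m j : ℕ) : ℤ)) := by
    filter_upwards [eventually_mem_Ioo_of_tendsto_nhdsGT' hu one_pos] with j hj
    have hρj : 0 < ρ (u j) := hρ _ ⟨hj.1, hj.2.le⟩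
    rw [mul_div_mul_left _ _ (pow_pos hρj 2).ne']
  have hlim := tendsto_nhds_unique (hQ.congr' hev') hR
  rw [div_eq_iff hApos.ne'] at hlim
  exact hlim

/-! ### (C2) From natural to real dilations -/

/-- **A continuous solution of `K(k s) = k^{-a} K(s)` (`k ∈ ℕ₊`, `s > 0`) is an exact power on `(0, ∞)`**:
`K(t) = t^{-a} K(1)` — at `s = 1/(N+1)` the naturals `k = N+1` and `k = ⌊(N+1)t⌋` give
`K(⌊(N+1)t⌋/(N+1)) = (⌊(N+1)t⌋/(N+1))^{-a} K(1)`, and `N → ∞` by continuity at `t`. [folklore] -/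
theorem rpow_law_of_natMul_law {K : ℝ → ℝ} {a : ℝ}
    (hnat : ∀ s : ℝ, 0 < s → ∀ k : ℕ, 1 ≤ k → K ((k : ℝ) * s) = (k : ℝ) ^ (-a) * K s)
    (hcont : ∀ r : ℝ, 0 < r → ContinuousAt K r) {t : ℝ} (ht : 0 < t) :
    K t = t ^ (-a) * K 1 := by
  -- meshes `δ_N = 1/(N+1) → 0⁺` and rational dilation factors `q_N = ⌊(N+1) t⌋ / (N+1) → t`
  set δ : ℕ → ℝ := fun N => 1 / ((N:ℝ) + 1) with hδ
  have hδpos : ∀ N, 0 < δ N := fun N => by rw [hδ]; positivity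
  have hδlim : Tendsto δ atTop (𝓝[>] (0:ℝ)) :=
    MoebiusLimitExistsNegative.tendsto_div_succ_nhdsGT one_pos
  set kN : ℕ → ℕ := fun N => ⌊t / δ N⌋₊ with hkN
  set q : ℕ → ℝ := fun N => δ N * (kN N : ℝ) with hq
  have hqlim : Tendsto q atTop (𝓝 t) := tendsto_mul_natFloor_div hδlim ht
  -- eventually `k_N ≥ 1`
  have hkev : ∀ᶠ N in atTop, 1 ≤ kN N := by
    have h1 : Tendsto (fun N => t / δ N) atTop atTop := by
      have h := (tendsto_inv_nhdsGT_zero.comp hδlim).const_mul_atTop ht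
      refine h.congr fun N => ?_
      simp [div_eq_mul_inv]
    exact (tendsto_nat_floor_atTop.comp h1).eventually_ge_atTop 1
  -- the identity at the rational dilation factors
  have hid : ∀ᶠ N in atTop, K (q N) = q N ^ (-a) * K 1 := by
    filter_upwards [hkev] with N hk1
    have hk0 : (0:ℝ) < kN N := by exact_mod_cast hk1
    have hN0 : (0:ℝ) < (N:ℝ) + 1 := by positivity
    have h1 := hnat (δ N) (hδpos N) (kN N) hk1
    have h2 := hnat (δ N) (hδpos N) (N + 1) (Nat.succ_le_succ (Nat.zero_le N))
    have hone : ((N + 1 : ℕ) : ℝ) * δ N = 1 := by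
      rw [hδ]
      push_cast
      field_simp
    rw [hone] at h2
    have hNa : (0:ℝ) < ((N + 1 : ℕ) : ℝ) ^ (-a) := Real.rpow_pos_of_pos (by positivity) _
    have hKδ : K (δ N) = K 1 / ((N + 1 : ℕ) : ℝ) ^ (-a) := by
      rw [h2, mul_div_cancel_left₀ _ hNa.ne']
    have hqN : q N = (kN N : ℝ) * δ N := by rw [hq, mul_comm]
    rw [hqN, h1, hKδ]
    have hqa : ((kN N : ℝ) * δ N) ^ (-a) = (kN N : ℝ) ^ (-a) / ((N + 1 : ℕ) : ℝ) ^ (-a) := by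
      rw [← Real.div_rpow hk0.le (by positivity), hδ]
      congr 1
      push_cast
      field_simp
    rw [hqa]
    ring
  -- pass to the limit `N → ∞` on both sides
  have hL : Tendsto (fun N => K (q N)) atTop (𝓝 (K t)) := (hcont t ht).tendsto.comp hqlim
  have hRlim : Tendsto (fun N => q N ^ (-a) * K 1) atTop (𝓝 (t ^ (-a) * K 1)) :=
    (hqlim.rpow_const (Or.inl ht.ne')).mul_const _
  exact tendsto_nhds_unique (hL.congr' hid) hRlim

end AxisKernel

open AxisKernel

/-! ### The two registered helpers -/

/-- **(C1) S2 gives item 4658 `UniformRegularity` of the pinned zoom.** The integer dilation law on the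
axis at `k = 2` along `n = 2^j` is the convergence of the dyadic pair ratio `g(2·2^j)/g(2^j) → 2^{-2Δ}` of the
pinned pair zoom; one convergent dyadic pair ratio gives `TwoPointDoubling`
(`stub_twoPointDoubling_of_dyadicPairRatio`, Messager–Miracle-Solé interpolation), and doubling gives
`UniformRegularity` (`uniformRegularity_of_doubling`, the reflection-positivity pedigree machinery).
[cite: DuminilCopinICM2022, §8.4] -/
theorem uniformRegularity_of_dilationLaw : (∃ Δ : ℝ, ∀ k : ℕ, 1 ≤ k → Filter.Tendsto (fun n : ℕ => Literature.Probability.LatticeModels.criticalTwoPoint 3 (Pi.single 0 ((k * n : ℕ) : ℤ)) * (k : ℝ) ^ (2 * Δ) / Literature.Probability.LatticeModels.criticalTwoPoint 3 (Pi.single 0 ((n : ℕ) : ℤ))) Filter.atTop (nhds 1)) → Summit.CriticalPhenomena.Ising3DConformalLimit.Theses.MonotoneRG.UniformRegularity := by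
  rintro ⟨Δ, hS2⟩
  exact uniformRegularity_of_doubling
    (stub_twoPointDoubling_of_dyadicPairRatio ⟨_, tendsto_dyadicPairRatio hS2⟩)

/-- **(C2) The axis kernel of a sequential pair limit is an exact power under S2.** For every sequential
pair limit `S₂` of the renormalised critical pair correlator along meshes `u k → 0⁺` (any renormalisation
`ρ > 0` on `(0,1]`, `S₂ > 0` off the diagonal) and every `t > 0`: `S₂(0, t e₀) = t^{-2Δ} S₂(0, e₀)` —
natural dilations by S2 at the moving rescaled sites (`kernel_natMul`), real dilations by the rational ones
`⌊(N+1)t⌋/(N+1) → t` and the continuity of the kernel off the origin (`continuousOn_seqLimit`).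
[cite: DuminilCopinICM2022, §8.4] -/
theorem kernel_axis_rpow_of_dilationLawAt : ∀ {Δ : ℝ}, (∀ k : ℕ, 1 ≤ k → Filter.Tendsto (fun n : ℕ => Literature.Probability.LatticeModels.criticalTwoPoint 3 (Pi.single 0 ((k * n : ℕ) : ℤ)) * (k : ℝ) ^ (2 * Δ) / Literature.Probability.LatticeModels.criticalTwoPoint 3 (Pi.single 0 ((n : ℕ) : ℤ))) Filter.atTop (nhds 1)) → ∀ {ρ : ℝ → ℝ}, (∀ δ ∈ Set.Ioc (0:ℝ) 1, 0 < ρ δ) → ∀ {u : ℕ → ℝ}, Filter.Tendsto u Filter.atTop (nhdsWithin (0:ℝ) (Set.Ioi 0)) → ∀ {S2 : (Fin 2 → EuclideanSpace ℝ (Fin 3)) → ℝ}, TendstoLocallyUniformlyOn (fun k => Literature.Probability.LatticeModels.rescaledCorrelator (Literature.Probability.LatticeModels.criticalCorr 3) ρ 2 (u k)) S2 Filter.atTop (Literature.Probability.LatticeModels.NonCoincident 3 2) → (∀ z ∈ Literature.Probability.LatticeModels.NonCoincident 3 2, 0 < S2 z) → ∀ t : ℝ, 0 < t → S2 ![0,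 EuclideanSpace.single 0 t] = t ^ (-(2 * Δ)) * S2 ![0, EuclideanSpace.single 0 1] := by
  intro Δ hS2 ρ hρ u hu S2 hconv2 hpos t ht
  -- the axis kernel `K r = S₂(0, r e₀)` and its continuity off `0`
  have hKcont : ∀ r : ℝ, 0 < r →
      ContinuousAt (fun r : ℝ => S2 ![0, r • EuclideanSpace.single (0 : Fin 3) (1:ℝ)]) r := by
    intro r hr
    have h1 : ContinuousOn (fun w : EuclideanSpace ℝ (Fin 3) => S2 ![0, w]) {0}ᶜ :=
      (continuousOn_seqLimit hu hconv2).comp continuous_zeroPair.continuousOn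
        fun _ hw => zero_pair_mem_nonCoincident hw
    have h2 : ContinuousAt (fun w : EuclideanSpace ℝ (Fin 3) => S2 ![0, w])
        (r • EuclideanSpace.single (0 : Fin 3) (1:ℝ)) :=
      h1.continuousAt (isOpen_compl_singleton.mem_nhds
        (smul_ne_zero hr.ne' single_zero_one_ne_zero))
    have hf : Continuous (fun r : ℝ => r • EuclideanSpace.single (0 : Fin 3) (1:ℝ)) :=
      continuous_id.smul continuous_const
    exact ContinuousAt.comp (g := fun w : EuclideanSpace ℝ (Fin 3) => S2 ![0, w]) h2 hf.continuousAt
  have h := rpow_law_of_natMul_law (K := fun r : ℝ => S2 ![0, r • EuclideanSpace.single (0 : Fin 3) (1:ℝ)])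
    (a := 2 * Δ) (fun s hs k hk => kernel_natMul hS2 hρ hu hconv2 hpos hs hk) hKcont ht
  simp only [one_smul] at h
  rw [smul_single_zero, mul_one] at h
  exact h

end Summit.CriticalPhenomena.Ising3DConformalLimit.Cruxes.IsingEuclidUpgradeR2RotInvPowerLaw.TowerProfileRigidity

end
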